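import Mathlib.GroupTheory.Perm.Cycle.Type
import Mathlib.GroupTheory.Perm.Cycle.Factors
import Mathlib.GroupTheory.Perm.Fin
import Mathlib.Combinatorics.SimpleGraph.Connectivity.Finite
import Literature.Topology.FourManifolds.KhResolutions
import HarnessLib

/-!
# Counting state circles: Seifert circles modulo `2`, and the effect of a merge or a split

Sibling proof file of `KhResolutions.lean` (layer 1 of the Khovanov–Lee–Rasmussen tower). It
proves two counting statements about the state circles `circleCount σ` of a Gauss diagram `G`
(abstract circle surgery, Viro (2004), §2, §5), both needed for the parity of quantum degrees
(Rasmussen (2010), §2.1: all `q`-gradings of a knot diagram are odd) and hence for the named fact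
`even_rasmussenInvariant` of `LeeRasmussen.lean`:

* **Seifert circles modulo two** (`even_circleCount_seifertState_add`): for *every* Gauss diagram
  with `n` chords, the number `k₀` of circles of the Seifert state (the orientation-consistent
  smoothing at every chord, `seifertState`) satisfies `k₀ ≡ n + 1 (mod 2)`. Classically this is
  `χ = k₀ - n = 1 - 2g` for the (orientable, one boundary component) Seifert surface of a knot
  diagram; the planarity-free proof given here identifies Seifert circles with the cycles of the
  permutation `partner ∘ succ` of the `2n` marked points (`seifertPerm`) and reads the parity of
  the number of cycles off its sign `(-1)ⁿ · (-1)^{2n-1}`.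
* **A merge loses one circle, a split gains one** (`circleCount_eq_of_isMergeAt`,
  `circleCount_eq_of_isSplitAt`): flipping the smoothing at a chord `i` changes the state graph
  only among the four arcs at `i`; far components are unchanged and the near ones number `1` or
  `2` according to whether the two local strands are joined (Viro (2004), §5.2: incident states
  differ by one Morse modification; Bar-Natan (2002), §3.1).

Everything here is total on `GaussDiagram` (virtual diagrams included) and uses no named fact;
the realisability-dependent input (every flip *is* a merge or a split) stays the named fact
`isMergeAt_or_isSplitAt_of_hasGaussDiagram` of `KhResolutions`.

## References

* O. Viro, *Khovanov homology, its definitions and ramifications*, Fund. Math. 184 (2004)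
  317–342, §2 (resolutions of a Gauss diagram), §5.2 (adjacent states differ by a Morse
  modification). [cite: Viro2004, §5.2]
* D. Bar-Natan, *On Khovanov's categorification of the Jones polynomial*, Algebr. Geom.
  Topol. 2 (2002), §3.1 (smoothings; the number of cycles `k`). [cite: BarNatan2002, §3.1]
* J. Rasmussen, *Khovanov homology and the slice genus*, Invent. Math. 182 (2010), §2.1
  (gradings of a knot are odd). [cite: Rasmussen2010, §2.1]
* Mathlib: `Equiv.Perm.sign_of_cycleType`, `Equiv.Perm.sum_cycleType`,
  `Equiv.Perm.cycleOf_mem_cycleFactorsFinset_iff`, `Equiv.Perm.cycle_is_cycleOf`,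
  `sign_finRotate`, `SimpleGraph.ConnectedComponent.lift`.
-/

open Function Set

noncomputable section

namespace Literature.Topology.FourManifolds

namespace GaussDiagram

variable (G : GaussDiagram)

/-! ## The Seifert state -/

/-- The **Seifert state** (oriented resolution) of a Gauss diagram: Seifert's smoothing at every
chord, i.e. the `0`-smoothing at the positive chords and the `1`-smoothing at the negative ones
(`isSeifert_seifertState`); it has weight `n₋`, so its enhanced states sit in homological
degree `0`. Bar-Natan (2002), §3.1; Rasmussen (2010), §2.3 (the oriented resolution).
[cite: Rasmussen2010, §2.3] -/
def seifertState : G.State := fun i ↦ !(G.sign i == 1)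

/-- At every chord the Seifert state takes Seifert's smoothing. [folklore] -/
@[simp] theorem isSeifert_seifertState (i : Fin G.n) : G.isSeifert G.seifertState i = true := by
  unfold isSeifert seifertState
  cases (G.sign i == 1) <;> rfl

/-- The weight of the Seifert state is the number `n₋` of negative chords (so the oriented
resolution has homological degree `weight - n₋ = 0`). Bar-Natan (2002), §3.1. [cite: BarNatan2002, §3.1] -/
theorem weight_seifertState : G.seifertState.weight = G.nMinus := by
  unfold State.weight nMinus seifertState
  congr 1
  apply Finset.filter_congr
  intro i _
  rcases Int.units_eq_one_or (G.sign i) with h | h <;> simp [h]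

/-- `n₊ + n₋ = n`: every chord is positive or negative. Bar-Natan (2002), §3.1. [cite: BarNatan2002, §3.1] -/
theorem nPlus_add_nMinus : G.nPlus + G.nMinus = G.n := by
  unfold nPlus nMinus
  have h : (Finset.univ.filter fun i ↦ G.sign i = -1) =
      Finset.univ.filter fun i ↦ ¬ G.sign i = 1 :=
    Finset.filter_congr fun i _ ↦ by
      rcases Int.units_eq_one_or (G.sign i) with h | h <;> simp [h]
  rw [h, Finset.card_filter_add_card_filter_not, Finset.card_univ, Fintype.card_fin]

/-! ## Seifert circles are the cycles of `partner ∘ succ` -/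

/-- The cyclic successor of marked points as a permutation of `Fin (2 * n)` (inverse: the cyclic
predecessor). [folklore] -/
def succPerm : Equiv.Perm (Fin (2 * G.n)) where
  toFun := G.succPt
  invFun := G.predPt
  left_inv := G.predPt_succPt
  right_inv := G.succPt_predPt

/-- The chord involution `partner` of marked points as a permutation. [folklore] -/
def partnerPerm : Equiv.Perm (Fin (2 * G.n)) :=
  Function.Involutive.toPerm G.partner G.partner_partner

/-- The **Seifert permutation** `p ↦ partner (p + 1)` of the marked points: following the knot
from `p` to the next marked point and then jumping along the chord. Its cycles are the Seifert
circles (`reachable_seifertState_iff_sameCycle`). Classical (Gauss; cf. Viro (2004), §2: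
circles of a resolution of a Gauss diagram). [cite: Viro2004, §2] -/
def seifertPerm : Equiv.Perm (Fin (2 * G.n)) := G.partnerPerm * G.succPerm

/-- `succPerm` is `succPt`. [folklore] -/
@[simp] theorem succPerm_apply (p : Fin (2 * G.n)) : G.succPerm p = G.succPt p := rfl

/-- `partnerPerm` is `partner`. [folklore] -/
@[simp] theorem partnerPerm_apply (p : Fin (2 * G.n)) : G.partnerPerm p = G.partner p := rfl

/-- `seifertPerm p = partner (succPt p)`. [folklore] -/
@[simp] theorem seifertPerm_apply (p : Fin (2 * G.n)) :
    G.seifertPerm p = G.partner (G.succPt p) := rfl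

/-- `succPerm` is Mathlib's rotation `finRotate (2 * n)`. [folklore] -/
theorem succPerm_eq_finRotate : G.succPerm = finRotate (2 * G.n) := by
  ext p
  haveI : NeZero (2 * G.n) := p.neZero
  rw [finRotate_apply]
  simp only [succPerm_apply, succPt, Fin.val_add, Fin.val_one', Nat.add_mod_mod]

/-- The sign of the rotation of the `2n ≥ 2` marked points is `-1`. [folklore] -/
theorem sign_succPerm (hn : 0 < G.n) : Equiv.Perm.sign G.succPerm = -1 := by
  rw [succPerm_eq_finRotate, sign_finRotate]
  obtain ⟨m, hm⟩ : ∃ m, 2 * G.n - 1 = 2 * m + 1 := ⟨G.n - 1, by omega⟩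
  rw [hm, pow_succ, pow_mul]
  simp

/-- `partner` has no fixed point: the support of `partnerPerm` is everything. [folklore] -/
theorem support_partnerPerm : G.partnerPerm.support = Finset.univ := by
  ext p
  simp [Equiv.Perm.mem_support, partner_ne]

/-- `partnerPerm` is an involution. [folklore] -/
theorem partnerPerm_sq : G.partnerPerm ^ 2 = 1 := by
  ext p
  simp [sq]

/-- `partnerPerm ≠ 1` as soon as there is a chord. [folklore] -/
theorem partnerPerm_ne_one (hn : 0 < G.n) : G.partnerPerm ≠ 1 := by
  intro h
  have h1 := congrArg (fun e : Equiv.Perm (Fin (2 * G.n)) ↦ e (G.overPos ⟨0, hn⟩)) h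
  simp only [partnerPerm_apply, partner_overPos, Equiv.Perm.coe_one, id_eq] at h1
  exact G.overPos_ne_underPos _ _ h1.symm

/-- The cycle type of the chord involution: `n` transpositions. [folklore] -/
theorem cycleType_partnerPerm (hn : 0 < G.n) :
    G.partnerPerm.cycleType = Multiset.replicate G.n 2 := by
  have h2 : orderOf G.partnerPerm = 2 :=
    orderOf_eq_prime G.partnerPerm_sq (G.partnerPerm_ne_one hn)
  obtain ⟨m, hm⟩ := Equiv.Perm.cycleType_prime_order (σ := G.partnerPerm)
    (by rw [h2]; exact Nat.prime_two)
  rw [h2] at hm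
  have hsum := G.partnerPerm.sum_cycleType
  rw [hm, Multiset.sum_replicate, support_partnerPerm, Finset.card_univ, Fintype.card_fin,
    smul_eq_mul] at hsum
  have hmn : m + 1 = G.n := by omega
  rw [hm, hmn]

/-- The sign of the chord involution (`n` transpositions) is `1` iff `n` is even. (Stated as a
parity equivalence rather than as `(-1)ⁿ` to stay clear of the two `Pow ℤˣ ℕ` instances.)
[folklore] -/
theorem sign_partnerPerm_eq_one_iff (hn : 0 < G.n) :
    Equiv.Perm.sign G.partnerPerm = 1 ↔ Even G.n := by
  rw [Equiv.Perm.sign_of_cycleType, G.cycleType_partnerPerm hn, Multiset.sum_replicate,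
    Multiset.card_replicate, smul_eq_mul, neg_one_pow_eq_one_iff_even (by decide),
    Nat.even_add, Nat.even_mul]
  simp

/-- The sign of the Seifert permutation is minus the sign of the chord involution (the rotation
of the `2n ≥ 2` marked points is odd). [folklore] -/
theorem sign_seifertPerm (hn : 0 < G.n) :
    Equiv.Perm.sign G.seifertPerm = -Equiv.Perm.sign G.partnerPerm := by
  rw [seifertPerm, map_mul, G.sign_succPerm hn, mul_neg_one]

/-- For `n ≥ 1` the marked point at which the arc `a` starts (the inverse of `arcOut`; the
arcs of a diagram with at least one chord are the `2n` intervals between marked points).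
[folklore] -/
def arcStart (hn : 0 < G.n) (a : G.Arc) : Fin (2 * G.n) :=
  ⟨a.val, by have := a.isLt; unfold arcCount at this; omega⟩

/-- `arcOut (arcStart a) = a`. [folklore] -/
@[simp] theorem arcOut_arcStart (hn : 0 < G.n) (a : G.Arc) : G.arcOut (G.arcStart hn a) = a :=
  Fin.ext rfl

/-- `arcStart (arcOut p) = p`. [folklore] -/
@[simp] theorem arcStart_arcOut (hn : 0 < G.n) (p : Fin (2 * G.n)) :
    G.arcStart hn (G.arcOut p) = p :=
  Fin.ext rfl

/-- One step of the Seifert permutation stays on the same Seifert circle: the arc leaving `p`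
enters `p + 1` and is glued there (Seifert smoothing) to the arc leaving `partner (p + 1)`.
Viro (2004), §2. [cite: Viro2004, §2] -/
theorem reachable_arcOut_seifertPerm (p : Fin (2 * G.n)) :
    (G.stateGraph G.seifertState).Reachable (G.arcOut p) (G.arcOut (G.seifertPerm p)) := by
  have h := G.reachable_endArc_endGlue G.seifertState (G.succPt p, false)
  simpa [endArc, endGlue] using h

/-- Iterating: `arcOut p` and `arcOut (seifertPerm ^ k p)` lie on the same Seifert circle.
[folklore] -/
theorem reachable_arcOut_seifertPerm_pow (p : Fin (2 * G.n)) (k : ℕ) :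
    (G.stateGraph G.seifertState).Reachable (G.arcOut p) (G.arcOut ((G.seifertPerm ^ k) p)) := by
  induction k with
  | zero => simp
  | succ k ih =>
    rw [pow_succ', Equiv.Perm.mul_apply]
    exact ih.trans (G.reachable_arcOut_seifertPerm _)

/-- Points on the same cycle of the Seifert permutation start arcs of the same Seifert circle.
[folklore] -/
theorem reachable_of_sameCycle {p q : Fin (2 * G.n)} (h : G.seifertPerm.SameCycle p q) :
    (G.stateGraph G.seifertState).Reachable (G.arcOut p) (G.arcOut q) := by
  obtain ⟨k, -, rfl⟩ := h.exists_pow_eq'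
  exact G.reachable_arcOut_seifertPerm_pow p k

/-- A gluing of the Seifert state joins arcs whose starting points lie on the same cycle of the
Seifert permutation. [folklore] -/
theorem sameCycle_of_stateAdj (hn : 0 < G.n) {a b : G.Arc} (h : G.stateAdj G.seifertState a b) :
    G.seifertPerm.SameCycle (G.arcStart hn a) (G.arcStart hn b) := by
  obtain ⟨-, p, hp⟩ := h
  rcases hp with ⟨-, ⟨rfl, rfl⟩ | ⟨rfl, rfl⟩⟩ | ⟨hs, -⟩
  · have he : G.seifertPerm (G.arcStart hn (G.arcIn p)) =
        G.arcStart hn (G.arcOut (G.partner p)) := by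
      rw [← arcOut_predPt, arcStart_arcOut, arcStart_arcOut, seifertPerm_apply, succPt_predPt]
    rw [← he]
    exact Equiv.Perm.sameCycle_apply_right.2 (Equiv.Perm.SameCycle.refl _ _)
  · have he : G.seifertPerm (G.arcStart hn (G.arcIn p)) =
        G.arcStart hn (G.arcOut (G.partner p)) := by
      rw [← arcOut_predPt, arcStart_arcOut, arcStart_arcOut, seifertPerm_apply, succPt_predPt]
    rw [← he]
    exact Equiv.Perm.sameCycle_apply_left.2 (Equiv.Perm.SameCycle.refl _ _)
  · simp at hs

/-- Arcs on the same Seifert circle start at points of the same cycle of the Seifert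
permutation. [folklore] -/
theorem sameCycle_of_reachable (hn : 0 < G.n) {a b : G.Arc}
    (h : (G.stateGraph G.seifertState).Reachable a b) :
    G.seifertPerm.SameCycle (G.arcStart hn a) (G.arcStart hn b) := by
  rw [SimpleGraph.reachable_iff_reflTransGen] at h
  induction h with
  | refl => exact Equiv.Perm.SameCycle.refl _ _
  | tail _ hadj ih =>
    rw [stateGraph, SimpleGraph.fromRel_adj] at hadj
    obtain ⟨-, h | h⟩ := hadj
    · exact ih.trans (G.sameCycle_of_stateAdj hn h)
    · exact ih.trans (G.sameCycle_of_stateAdj hn h).symm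

/-- **Seifert circles are the cycles of the Seifert permutation**: two arcs lie on the same
circle of the Seifert state iff their starting points lie on the same cycle of
`p ↦ partner (p + 1)`. Classical (Gauss words; Viro (2004), §2). [cite: Viro2004, §2] -/
theorem reachable_seifertState_iff_sameCycle (hn : 0 < G.n) (a b : G.Arc) :
    (G.stateGraph G.seifertState).Reachable a b ↔
      G.seifertPerm.SameCycle (G.arcStart hn a) (G.arcStart hn b) := by
  refine ⟨G.sameCycle_of_reachable hn, fun h ↦ ?_⟩
  simpa using G.reachable_of_sameCycle h

/-! ## Counting the cycles of a permutation modulo `2` -/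

section Perm

variable {α : Type*} [Fintype α] [DecidableEq α] (f : Equiv.Perm α)

/-- The **cycle class** of a point `x` under a permutation `f` of a finite type: the cycle of
`f` through `x` (an element of `cycleFactorsFinset f`) if `x` is moved, and `x` itself if it is
fixed. Two points have the same cycle class iff they lie on the same cycle
(`cycleClass_eq_iff_sameCycle`), and every class occurs (`cycleClass_surjective`), so the
classes of `SameCycle f` are counted by `#cycleFactorsFinset f + #fixed points`. [folklore] -/
def cycleClass (x : α) : {c // c ∈ f.cycleFactorsFinset} ⊕ {x // f x = x} :=
  if h : f x = x then Sum.inr ⟨x, h⟩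
  else Sum.inl ⟨f.cycleOf x,
    Equiv.Perm.cycleOf_mem_cycleFactorsFinset_iff.2 (Equiv.Perm.mem_support.2 h)⟩

omit [Fintype α] [DecidableEq α] in
/-- A point fixed by `f` is alone on its cycle. [folklore] -/
theorem eq_of_sameCycle_of_apply_eq {f : Equiv.Perm α} {x y : α} (h : f.SameCycle x y)
    (hx : f x = x) : y = x := by
  obtain ⟨k, rfl⟩ := h
  exact Equiv.Perm.zpow_apply_eq_self_of_apply_eq_self hx k

/-- Two points have the same cycle class iff they lie on the same cycle. [folklore] -/
theorem cycleClass_eq_iff_sameCycle (x y : α) :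
    cycleClass f x = cycleClass f y ↔ f.SameCycle x y := by
  unfold cycleClass
  by_cases hx : f x = x <;> by_cases hy : f y = y
  · simp only [hx, hy, dite_true, Sum.inr.injEq, Subtype.mk.injEq]
    exact ⟨fun h ↦ h ▸ Equiv.Perm.SameCycle.refl _ _,
      fun h ↦ (eq_of_sameCycle_of_apply_eq h hx).symm⟩
  · simp only [hx, hy, dite_true, dite_false, reduceCtorEq, false_iff]
    exact fun h ↦ hy (by rw [eq_of_sameCycle_of_apply_eq h hx]; exact hx)
  · simp only [hx, hy, dite_true, dite_false, reduceCtorEq, false_iff]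
    exact fun h ↦ hx (by rw [eq_of_sameCycle_of_apply_eq h.symm hy]; exact hy)
  · simp only [hx, hy, dite_false, Sum.inl.injEq, Subtype.mk.injEq]
    exact (Equiv.Perm.sameCycle_iff_cycleOf_eq_of_mem_support (Equiv.Perm.mem_support.2 hx)
      (Equiv.Perm.mem_support.2 hy)).symm

/-- Every cycle factor and every fixed point is the cycle class of some point. [folklore] -/
theorem cycleClass_surjective : Function.Surjective (cycleClass f) := by
  rintro (⟨c, hc⟩ | ⟨x, hx⟩)
  · obtain ⟨a, ha⟩ := (Equiv.Perm.mem_cycleFactorsFinset_iff.1 hc).1.nonempty_support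
    have hfa : f a ≠ a :=
      Equiv.Perm.mem_support.1 (Equiv.Perm.mem_cycleFactorsFinset_support_le hc ha)
    refine ⟨a, ?_⟩
    simp only [cycleClass, hfa, dite_false, Sum.inl.injEq, Subtype.mk.injEq]
    exact (Equiv.Perm.cycle_is_cycleOf ha hc).symm
  · exact ⟨x, by simp [cycleClass, hx]⟩

/-- **Parity of the number of cycles.** For a permutation `f` of a finite type with `N`
elements, `sign f = 1` iff `N + #cycles` is even, where cycles are counted including fixed
points (`#cycleFactorsFinset f + #{x | f x = x}`): a cycle of length `ℓ` has sign
`(-1)^(ℓ - 1)`. [folklore] -/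
theorem sign_eq_one_iff_even_card_add_card_cycleClass :
    Equiv.Perm.sign f = 1 ↔ Even (Fintype.card α +
      (f.cycleFactorsFinset.card + Fintype.card {x // f x = x})) := by
  have h1 : Fintype.card {x // f x = x} = Fintype.card α - f.cycleType.sum := by
    rw [← Equiv.Perm.card_fixedPoints]
    exact Fintype.card_congr (_root_.Equiv.refl _)
  have h2 : f.cycleFactorsFinset.card = Multiset.card f.cycleType := by
    rw [Equiv.Perm.cycleType_def, Multiset.card_map]
    rfl
  have h3 : f.cycleType.sum ≤ Fintype.card α := f.sum_cycleType_le
  rw [Equiv.Perm.sign_of_cycleType, neg_one_pow_eq_one_iff_even (by decide), h1, h2,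
    Nat.even_iff, Nat.even_iff]
  omega

end Perm

/-! ## Seifert circles modulo `2` -/

/-- For `n ≥ 1`, the circles of the Seifert state are in bijection with the cycle classes of
the Seifert permutation (cycle factors and fixed points of `p ↦ partner (p + 1)`): the number
of Seifert circles is the number of cycles of `partner ∘ succ`. Classical (Gauss words);
Viro (2004), §2. [cite: Viro2004, §2] -/
theorem circleCount_seifertState_eq (hn : 0 < G.n) :
    G.circleCount G.seifertState =
      G.seifertPerm.cycleFactorsFinset.card + Fintype.card {p // G.seifertPerm p = p} := by
  classical
  let Θ : G.StateCircle G.seifertState →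
      {c // c ∈ G.seifertPerm.cycleFactorsFinset} ⊕ {p // G.seifertPerm p = p} :=
    SimpleGraph.ConnectedComponent.lift (fun a ↦ cycleClass G.seifertPerm (G.arcStart hn a))
      (fun a b w _ ↦ (cycleClass_eq_iff_sameCycle _ _ _).2
        (G.sameCycle_of_reachable hn ⟨w⟩))
  have hΘ : ∀ a, Θ (G.circleOf G.seifertState a) =
      cycleClass G.seifertPerm (G.arcStart hn a) := fun a ↦ rfl
  have hbij : Function.Bijective Θ := by
    constructor
    · intro c d h
      induction c using SimpleGraph.ConnectedComponent.ind with
      | h a =>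
      induction d using SimpleGraph.ConnectedComponent.ind with
      | h b =>
      change Θ (G.circleOf _ a) = Θ (G.circleOf _ b) at h
      rw [hΘ, hΘ, cycleClass_eq_iff_sameCycle] at h
      exact SimpleGraph.ConnectedComponent.sound
        ((G.reachable_seifertState_iff_sameCycle hn a b).2 h)
    · intro y
      obtain ⟨p, rfl⟩ := cycleClass_surjective G.seifertPerm y
      exact ⟨G.circleOf _ (G.arcOut p), by rw [hΘ, arcStart_arcOut]⟩
  rw [circleCount, Fintype.card_of_bijective hbij, Fintype.card_sum, Fintype.card_coe]

/-- A diagram without chords has exactly one state circle in every state (its single arc).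
Bar-Natan (2002), §3.1 (the crossingless unknot). [cite: BarNatan2002, §3.1] -/
theorem circleCount_of_n_eq_zero (hn : G.n = 0) (σ : G.State) : G.circleCount σ = 1 := by
  have hA : Fintype.card G.Arc = 1 := by simp [arcCount, hn]
  haveI : Subsingleton G.Arc := Fintype.card_le_one_iff_subsingleton.mp hA.le
  obtain ⟨a⟩ : Nonempty G.Arc := Fintype.card_pos_iff.mp (by omega)
  rw [circleCount, Fintype.card_eq_one_iff]
  refine ⟨G.circleOf σ a, fun c ↦ ?_⟩
  induction c using SimpleGraph.ConnectedComponent.ind with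
  | h b => exact congrArg _ (Subsingleton.elim _ _)

/-- **Seifert circles modulo two.** For every Gauss diagram with `n` chords, the number `k₀` of
circles of the Seifert state (oriented resolution) satisfies `k₀ + n + 1 ≡ 0 (mod 2)`, i.e.
`k₀ ≡ n + 1`. For a knot diagram this is `χ(Seifert surface) = k₀ - n = 1 - 2g`; the present
planarity-free statement (valid for virtual diagrams too: surgery of a disc along `n`
orientation-preserving bands is an orientable surface with `k₀ ≡ 1 + n` boundary circles) is
proved by `sign (partner ∘ succ) = (-1)ⁿ · (-1)^{2n-1} = (-1)^{2n + #cycles}`.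
Rasmussen (2010), §2.1 uses the consequence that all `q`-gradings of a knot are odd.
[cite: Rasmussen2010, §2.1] -/
theorem even_circleCount_seifertState_add : Even (G.circleCount G.seifertState + G.n + 1) := by
  rcases Nat.eq_zero_or_pos G.n with hn | hn
  · rw [G.circleCount_of_n_eq_zero hn, hn]
    exact ⟨1, rfl⟩
  have hs := sign_eq_one_iff_even_card_add_card_cycleClass G.seifertPerm
  rw [G.sign_seifertPerm hn, ← G.circleCount_seifertState_eq hn, Fintype.card_fin] at hs
  have hp := G.sign_partnerPerm_eq_one_iff hn
  rw [Nat.even_iff] at hs hp ⊢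
  rcases Int.units_eq_one_or (Equiv.Perm.sign G.partnerPerm) with h | h <;>
    simp only [h, true_iff, false_iff, neg_neg, neg_units_ne_self] at hs hp <;>
    omega

/-! ## Flipping the smoothing at one chord

Let `σ, σ'` be two states of `G` which agree at every chord other than `i`, and let
`o = overPos i`, `u = underPos i`. The state graphs of `σ` and `σ'` (Viro's reconnection graphs
on arcs) differ only in edges among the four *arcs at `i`*: `arcIn o, arcOut o, arcIn u, arcOut u`
(`adj_iff_of_not_isArcAt`). Hence the set of arcs *near* `i` (on a circle through one of these
four arcs) is the same for both states, circles far from `i` are literally the same, and the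
near circles number `1` or `2` according to whether `arcIn o` and `arcOut o` are joined
(`circleCount_add_eq`). Viro (2004), §5.2; Bar-Natan (2002), §3.1. -/

section Surgery

variable {G}

/-- The four **arcs at the chord** `i`: the arcs entering and leaving its two marked points
`overPos i`, `underPos i`. [folklore] -/
def IsArcAt (G : GaussDiagram) (i : Fin G.n) (a : G.Arc) : Prop :=
  a = G.arcIn (G.overPos i) ∨ a = G.arcOut (G.overPos i) ∨
    a = G.arcIn (G.underPos i) ∨ a = G.arcOut (G.underPos i)

/-- A marked point whose chord is `i` is one of the two ends of `i`. [folklore] -/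
theorem eq_or_eq_of_chordOf_eq {i : Fin G.n} {p : Fin (2 * G.n)} (h : G.chordOf p = i) :
    p = G.overPos i ∨ p = G.underPos i := by
  rcases G.chordOf_spec p with h' | h'
  · exact Or.inl (by rw [← h', h])
  · exact Or.inr (by rw [← h', h])

/-- The arcs entering and leaving an end of chord `i`, or its partner, are arcs at `i`. [folklore] -/
theorem isArcAt_of_chordOf_eq {i : Fin G.n} {p : Fin (2 * G.n)} (h : G.chordOf p = i) :
    G.IsArcAt i (G.arcIn p) ∧ G.IsArcAt i (G.arcOut p) ∧
      G.IsArcAt i (G.arcIn (G.partner p)) ∧ G.IsArcAt i (G.arcOut (G.partner p)) := by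
  rcases eq_or_eq_of_chordOf_eq h with rfl | rfl
  · simp [IsArcAt]
  · simp [IsArcAt]

/-- The Seifert rule at a chord only depends on the smoothing at that chord. [folklore] -/
theorem isSeifert_congr {σ σ' : G.State} {j : Fin G.n} (h : σ' j = σ j) :
    G.isSeifert σ' j = G.isSeifert σ j := by
  simp [isSeifert, h]

variable {σ σ' : G.State} {i : Fin G.n}

/-- **Locality of the reconnection relation.** If `σ'` agrees with `σ` off the chord `i`, a
reconnection of `σ` between two arcs *not both at `i`* is a reconnection of `σ'`.
Viro (2004), §5.2. [cite: Viro2004, §5.2] -/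
theorem stateAdj_of_stateAdj_of_not_isArcAt (hσ : ∀ j, j ≠ i → σ' j = σ j) {a b : G.Arc}
    (h : G.stateAdj σ a b) (hab : ¬ (G.IsArcAt i a ∧ G.IsArcAt i b)) : G.stateAdj σ' a b := by
  obtain ⟨hne, p, hp⟩ := h
  by_cases hc : G.chordOf p = i
  · obtain ⟨h1, h2, h3, h4⟩ := isArcAt_of_chordOf_eq hc
    exfalso
    apply hab
    rcases hp with ⟨-, ⟨rfl, rfl⟩ | ⟨rfl, rfl⟩⟩ | ⟨-, ⟨rfl, rfl⟩ | ⟨rfl, rfl⟩⟩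
    · exact ⟨h1, h4⟩
    · exact ⟨h4, h1⟩
    · exact ⟨h1, h3⟩
    · exact ⟨h2, h4⟩
  · refine ⟨hne, p, ?_⟩
    rw [isSeifert_congr (hσ _ hc)]
    exact hp

/-- **Locality of the state graph.** States agreeing off the chord `i` have the same
adjacencies between arcs not both at `i`. Viro (2004), §5.2. [cite: Viro2004, §5.2] -/
theorem adj_iff_of_not_isArcAt (hσ : ∀ j, j ≠ i → σ' j = σ j) {a b : G.Arc}
    (hab : ¬ (G.IsArcAt i a ∧ G.IsArcAt i b)) :
    (G.stateGraph σ).Adj a b ↔ (G.stateGraph σ').Adj a b := by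
  have hσ' : ∀ j, j ≠ i → σ j = σ' j := fun j hj ↦ (hσ j hj).symm
  have hba : ¬ (G.IsArcAt i b ∧ G.IsArcAt i a) := fun h ↦ hab ⟨h.2, h.1⟩
  simp only [stateGraph, SimpleGraph.fromRel_adj]
  constructor
  · rintro ⟨hne, h | h⟩
    · exact ⟨hne, Or.inl (stateAdj_of_stateAdj_of_not_isArcAt hσ h hab)⟩
    · exact ⟨hne, Or.inr (stateAdj_of_stateAdj_of_not_isArcAt hσ h hba)⟩
  · rintro ⟨hne, h | h⟩
    · exact ⟨hne, Or.inl (stateAdj_of_stateAdj_of_not_isArcAt hσ' h hab)⟩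
    · exact ⟨hne, Or.inr (stateAdj_of_stateAdj_of_not_isArcAt hσ' h hba)⟩

/-- An arc is **near** the chord `i` in the state `σ` if it lies on the state circle of one of
the four arcs at `i`. [folklore] -/
def Near (G : GaussDiagram) (σ : G.State) (i : Fin G.n) (a : G.Arc) : Prop :=
  ∃ s, G.IsArcAt i s ∧ (G.stateGraph σ).Reachable s a

/-- Nearness is a property of state circles. [folklore] -/
theorem Near.of_reachable {a b : G.Arc} (h : G.Near σ i a) (hab : (G.stateGraph σ).Reachable a b) :
    G.Near σ i b := by
  obtain ⟨s, hs, hr⟩ := h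
  exact ⟨s, hs, hr.trans hab⟩

/-- States agreeing off `i` have the same near arcs (one inclusion; the statement is
symmetric). Viro (2004), §5.2. [cite: Viro2004, §5.2] -/
theorem Near.of_agree (hσ : ∀ j, j ≠ i → σ' j = σ j) {a : G.Arc} (h : G.Near σ i a) :
    G.Near σ' i a := by
  obtain ⟨s, hs, hr⟩ := h
  rw [SimpleGraph.reachable_iff_reflTransGen] at hr
  induction hr with
  | refl => exact ⟨s, hs, SimpleGraph.Reachable.refl _⟩
  | @tail y z _ hyz ih =>
    by_cases hbo : G.IsArcAt i y ∧ G.IsArcAt i z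
    · exact ⟨z, hbo.2, SimpleGraph.Reachable.refl _⟩
    · obtain ⟨s', hs', hr'⟩ := ih
      exact ⟨s', hs', hr'.trans ((adj_iff_of_not_isArcAt hσ hbo).1 hyz).reachable⟩

/-- States agreeing off `i` have the same near arcs. Viro (2004), §5.2. [cite: Viro2004, §5.2] -/
theorem near_iff_of_agree (hσ : ∀ j, j ≠ i → σ' j = σ j) (a : G.Arc) :
    G.Near σ i a ↔ G.Near σ' i a :=
  ⟨Near.of_agree hσ, Near.of_agree fun j hj ↦ (hσ j hj).symm⟩

/-- **Far circles are unchanged.** From an arc far from `i`, the states `σ` and `σ'` (agreeing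
off `i`) reach the same arcs (one inclusion). Viro (2004), §5.2. [cite: Viro2004, §5.2] -/
theorem reachable_of_agree_of_not_near (hσ : ∀ j, j ≠ i → σ' j = σ j) {a b : G.Arc}
    (ha : ¬ G.Near σ i a) (h : (G.stateGraph σ).Reachable a b) :
    (G.stateGraph σ').Reachable a b := by
  rw [SimpleGraph.reachable_iff_reflTransGen] at h
  induction h with
  | refl => exact SimpleGraph.Reachable.refl _
  | @tail y z hay hyz ih =>
    by_cases hbo : G.IsArcAt i y ∧ G.IsArcAt i z
    · exact (ha ⟨y, hbo.1,
        ((SimpleGraph.reachable_iff_reflTransGen _ _).2 hay).symm⟩).elim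
    · exact ih.trans ((adj_iff_of_not_isArcAt hσ hbo).1 hyz).reachable

/-- **Far circles are unchanged**: from an arc far from `i`, states agreeing off `i` reach the
same arcs. Viro (2004), §5.2. [cite: Viro2004, §5.2] -/
theorem reachable_iff_of_agree_of_not_near (hσ : ∀ j, j ≠ i → σ' j = σ j) {a : G.Arc}
    (ha : ¬ G.Near σ i a) (b : G.Arc) :
    (G.stateGraph σ).Reachable a b ↔ (G.stateGraph σ').Reachable a b :=
  ⟨reachable_of_agree_of_not_near hσ ha,
    reachable_of_agree_of_not_near (fun j hj ↦ (hσ j hj).symm)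
      (fun h ↦ ha ((near_iff_of_agree hσ a).2 h))⟩

/-- The arc entering or leaving `underPos i` is glued at chord `i` to the arc entering or to the
arc leaving `overPos i`, in every state. [folklore] -/
theorem reachable_overPos_underPos (σ : G.State) (i : Fin G.n) (b : Bool) :
    (G.stateGraph σ).Reachable (G.arcIn (G.overPos i)) (G.endArc (G.underPos i, b)) ∨
      (G.stateGraph σ).Reachable (G.arcOut (G.overPos i)) (G.endArc (G.underPos i, b)) := by
  have h := (G.reachable_endArc_endGlue σ (G.underPos i, b)).symm
  cases hs : G.isSeifert σ i <;> cases b <;>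
    simp only [endGlue, endArc, chordOf_underPos, partner_underPos, hs, Bool.not_false,
      Bool.not_true, if_true, if_false, Bool.false_eq_true] at h <;>
    first | exact Or.inl h | exact Or.inr h

/-- The near arcs are those on the circles of `arcIn (overPos i)` and `arcOut (overPos i)`
(the other two arcs at `i` are glued to these at the chord `i`). [folklore] -/
theorem near_iff (a : G.Arc) : G.Near σ i a ↔
    (G.stateGraph σ).Reachable (G.arcIn (G.overPos i)) a ∨
      (G.stateGraph σ).Reachable (G.arcOut (G.overPos i)) a := by
  constructor
  · rintro ⟨s, hs, hr⟩
    rcases hs with rfl | rfl | rfl | rfl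
    · exact Or.inl hr
    · exact Or.inr hr
    · rcases G.reachable_overPos_underPos σ i false with h | h
      · exact Or.inl (h.trans hr)
      · exact Or.inr (h.trans hr)
    · rcases G.reachable_overPos_underPos σ i true with h | h
      · exact Or.inl (h.trans hr)
      · exact Or.inr (h.trans hr)
  · rintro (h | h)
    · exact ⟨_, Or.inl rfl, h⟩
    · exact ⟨_, Or.inr (Or.inl rfl), h⟩

/-! ### Counting circles by their least arc -/

variable (G) in
/-- The **least arc** on the state circle of `a` (a canonical representative of the circle).
[folklore] -/
def minArc (σ : G.State) (a : G.Arc) : G.Arc :=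
  (Finset.univ.filter fun b ↦ (G.stateGraph σ).Reachable a b).min'
    ⟨a, Finset.mem_filter.2 ⟨Finset.mem_univ _, SimpleGraph.Reachable.refl _⟩⟩

/-- The least arc of a circle lies on it. [folklore] -/
theorem reachable_minArc (σ : G.State) (a : G.Arc) :
    (G.stateGraph σ).Reachable a (G.minArc σ a) := by
  have h := Finset.min'_mem (Finset.univ.filter fun b ↦ (G.stateGraph σ).Reachable a b)
    ⟨a, Finset.mem_filter.2 ⟨Finset.mem_univ _, SimpleGraph.Reachable.refl _⟩⟩
  exact (Finset.mem_filter.1 h).2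

/-- The least arc of a circle is at most every arc on it. [folklore] -/
theorem minArc_le {σ : G.State} {a b : G.Arc} (h : (G.stateGraph σ).Reachable a b) :
    G.minArc σ a ≤ b :=
  Finset.min'_le _ _ (Finset.mem_filter.2 ⟨Finset.mem_univ _, h⟩)

/-- Arcs on the same circle have the same least arc. [folklore] -/
theorem minArc_eq_of_reachable {σ : G.State} {a b : G.Arc} (h : (G.stateGraph σ).Reachable a b) :
    G.minArc σ a = G.minArc σ b :=
  le_antisymm (minArc_le (h.trans (G.reachable_minArc σ b)))
    (minArc_le (h.symm.trans (G.reachable_minArc σ a)))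

/-- `minArc` is idempotent. [folklore] -/
theorem minArc_minArc (σ : G.State) (a : G.Arc) : G.minArc σ (G.minArc σ a) = G.minArc σ a :=
  (minArc_eq_of_reachable (G.reachable_minArc σ a)).symm

/-- Two arcs have the same least arc iff they lie on the same circle. [folklore] -/
theorem minArc_eq_iff {σ : G.State} {a b : G.Arc} :
    G.minArc σ a = G.minArc σ b ↔ (G.stateGraph σ).Reachable a b :=
  ⟨fun h ↦ (G.reachable_minArc σ a).trans (h ▸ (G.reachable_minArc σ b).symm),
    minArc_eq_of_reachable⟩

variable (G) in
/-- **Circles are counted by their least arcs**: `circleCount σ` is the number of arcs that are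
the least arc of their circle. [folklore] -/
theorem circleCount_eq_card_filter_minArc (σ : G.State) :
    G.circleCount σ = (Finset.univ.filter fun a : G.Arc ↦ G.minArc σ a = a).card := by
  let e : G.StateCircle σ ≃ {a : G.Arc // G.minArc σ a = a} :=
    { toFun := SimpleGraph.ConnectedComponent.lift (fun a ↦ ⟨G.minArc σ a, G.minArc_minArc σ a⟩)
        (fun a b w _ ↦ Subtype.ext (minArc_eq_of_reachable ⟨w⟩))
      invFun := fun x ↦ G.circleOf σ x.1
      left_inv := fun c ↦ by
        induction c using SimpleGraph.ConnectedComponent.ind with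
        | h a => exact SimpleGraph.ConnectedComponent.sound (G.reachable_minArc σ a).symm
      right_inv := fun x ↦ Subtype.ext x.2 }
  rw [circleCount, Fintype.card_congr e, Fintype.card_subtype]

open Classical in
/-- The near arcs that are least on their circle are the least arcs of the circles of
`arcIn (overPos i)` and `arcOut (overPos i)`. [folklore] -/
theorem filter_near_minArc (σ : G.State) (i : Fin G.n) :
    (Finset.univ.filter fun a : G.Arc ↦ G.Near σ i a ∧ G.minArc σ a = a) =
      {G.minArc σ (G.arcIn (G.overPos i)), G.minArc σ (G.arcOut (G.overPos i))} := by
  ext a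
  simp only [Finset.mem_filter, Finset.mem_univ, true_and, Finset.mem_insert,
    Finset.mem_singleton]
  constructor
  · rintro ⟨hn, ha⟩
    rcases (near_iff a).1 hn with h | h
    · exact Or.inl (by rw [minArc_eq_of_reachable h, ha])
    · exact Or.inr (by rw [minArc_eq_of_reachable h, ha])
  · rintro (rfl | rfl)
    · exact ⟨⟨_, Or.inl rfl, G.reachable_minArc σ _⟩, G.minArc_minArc σ _⟩
    · exact ⟨⟨_, Or.inr (Or.inl rfl), G.reachable_minArc σ _⟩, G.minArc_minArc σ _⟩

open Classical in
/-- States agreeing off `i` have the same far least arcs. Viro (2004), §5.2. [cite: Viro2004, §5.2] -/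
theorem filter_not_near_minArc_eq (hσ : ∀ j, j ≠ i → σ' j = σ j) :
    (Finset.univ.filter fun a : G.Arc ↦ ¬ G.Near σ i a ∧ G.minArc σ a = a) =
      Finset.univ.filter fun a : G.Arc ↦ ¬ G.Near σ' i a ∧ G.minArc σ' a = a := by
  apply Finset.filter_congr
  intro a _
  rw [← near_iff_of_agree hσ a]
  refine and_congr_right fun ha ↦ ?_
  have ha' : ¬ G.Near σ' i a := fun h ↦ ha ((near_iff_of_agree hσ a).2 h)
  have hσ' : ∀ j, j ≠ i → σ j = σ' j := fun j hj ↦ (hσ j hj).symm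
  have heq : G.minArc σ a = G.minArc σ' a :=
    le_antisymm
      (minArc_le ((reachable_iff_of_agree_of_not_near hσ' ha' _).1 (G.reachable_minArc σ' a)))
      (minArc_le ((reachable_iff_of_agree_of_not_near hσ ha _).1 (G.reachable_minArc σ a)))
  rw [heq]

variable (G) in
/-- The number of **near circles** at the chord `i` in the state `σ`: `1` if the arcs entering
and leaving `overPos i` lie on the same circle, `2` otherwise (every arc at `i` lies on one of
these circles). [folklore] -/
def nearCount (σ : G.State) (i : Fin G.n) : ℕ :=
  if (G.stateGraph σ).Reachable (G.arcIn (G.overPos i)) (G.arcOut (G.overPos i)) then 1 else 2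

/-- The near circles are counted by `nearCount`. [folklore] -/
theorem card_pair_minArc (σ : G.State) (i : Fin G.n) :
    ({G.minArc σ (G.arcIn (G.overPos i)), G.minArc σ (G.arcOut (G.overPos i))} : Finset G.Arc).card
      = G.nearCount σ i := by
  unfold nearCount
  split_ifs with h
  · rw [minArc_eq_of_reachable h, Finset.pair_eq_singleton, Finset.card_singleton]
  · exact Finset.card_pair fun he ↦ h (minArc_eq_iff.1 he)

open Classical in
/-- **Surgery count.** If the states `σ, σ'` agree off the chord `i`, then
`circleCount σ + nearCount σ' i = circleCount σ' + nearCount σ i`: far circles are the same and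
the near circles number `nearCount`. This is the combinatorial form of Viro's remark that
incident states differ by a single Morse modification at the chord `i` (Viro (2004), §5.2;
Bar-Natan (2002), §3.1). [cite: Viro2004, §5.2] -/
theorem circleCount_add_nearCount_eq (hσ : ∀ j, j ≠ i → σ' j = σ j) :
    G.circleCount σ + G.nearCount σ' i = G.circleCount σ' + G.nearCount σ i := by
  have key : ∀ τ : G.State, G.circleCount τ = G.nearCount τ i +
      (Finset.univ.filter fun a : G.Arc ↦ ¬ G.Near τ i a ∧ G.minArc τ a = a).card := by
    intro τ
    rw [G.circleCount_eq_card_filter_minArc τ, ← card_pair_minArc, ← filter_near_minArc,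
      ← Finset.card_filter_add_card_filter_not (fun a ↦ G.Near τ i a)]
    simp only [Finset.filter_filter]
    congr 1
    · congr 1
      exact Finset.filter_congr fun a _ ↦ and_comm
    · congr 1
      exact Finset.filter_congr fun a _ ↦ and_comm
  rw [key σ, key σ', filter_not_near_minArc_eq hσ]
  ring

/-- **A merge loses exactly one circle.** If the flip `0 → 1` at the chord `i` is a merge in the
state `σ`, the new state has one circle fewer. Viro (2004), §5.2 (an index-`1` Morse
modification joining two circles); Khovanov (2000), §4.2; Bar-Natan (2002), §3.1. [cite: Viro2004, §5.2] -/
theorem circleCount_eq_of_isMergeAt {σ : G.State} {i : Fin G.n} (h : G.IsMergeAt σ i) :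
    G.circleCount σ = G.circleCount (Function.update σ i true) + 1 := by
  have hσ : ∀ j, j ≠ i → Function.update σ i true j = σ j := fun j hj ↦
    Function.update_of_ne hj _ _
  have hS := IsMergeAt.not_isSplitAt_holds h
  have h1 : G.nearCount σ i = 2 := by
    rw [nearCount, if_neg]
    exact fun hr ↦ h.2 (SimpleGraph.ConnectedComponent.sound hr)
  have h2 : G.nearCount (Function.update σ i true) i = 1 := by
    rw [nearCount, if_pos]
    by_contra hr
    exact hS ⟨h.1, fun he ↦ hr (SimpleGraph.ConnectedComponent.exact he)⟩
  have := circleCount_add_nearCount_eq hσ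
  omega

/-- **A split gains exactly one circle.** If the flip `0 → 1` at the chord `i` is a split in the
state `σ`, the new state has one circle more. Viro (2004), §5.2; Khovanov (2000), §4.2;
Bar-Natan (2002), §3.1. [cite: Viro2004, §5.2] -/
theorem circleCount_eq_of_isSplitAt {σ : G.State} {i : Fin G.n} (h : G.IsSplitAt σ i) :
    G.circleCount (Function.update σ i true) = G.circleCount σ + 1 := by
  have hσ : ∀ j, j ≠ i → Function.update σ i true j = σ j := fun j hj ↦
    Function.update_of_ne hj _ _
  have hM : ¬ G.IsMergeAt σ i := fun hM ↦ IsMergeAt.not_isSplitAt_holds hM h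
  have h1 : G.nearCount σ i = 1 := by
    rw [nearCount, if_pos]
    by_contra hr
    exact hM ⟨h.1, fun he ↦ hr (SimpleGraph.ConnectedComponent.exact he)⟩
  have h2 : G.nearCount (Function.update σ i true) i = 2 := by
    rw [nearCount, if_neg]
    exact fun hr ↦ h.2 (SimpleGraph.ConnectedComponent.sound hr)
  have := circleCount_add_nearCount_eq hσ
  omega

end Surgery

end GaussDiagram

end Literature.Topology.FourManifolds
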